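import Summits.NavierStokesRegularity.NavierStokesRegularity.Theorems.PerpetualPumpCircuitPumpTrailSlaving

/-!
# Deep trail bonds for truncated Toda solutions (crux `PerpetualPump.CircuitPump`,
# stmt-NavierStokesRegularity-1834; line `singular-clock-gspt`, sub-goal `toda_trail_bonds_deep`)

Pure real analysis for the `L`-truncated seeded graded Toda lattice (carrier `a n`, bond `b n`,
modes `|n| > L` read as `0` on `[0, T]`, right derivatives on `[0, T)`), `1 < lam ≤ 2`,
`q = lam^{1/5}`. Under the hypotheses of `toda_trail_slaving` the crude carrier envelope
`|a(-j)| ≤ 2 ρ̄ qʲ` holds on the whole window for every `j ≥ 1` (third conclusion of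
`toda_trail_slaving` plus the smallness `F T ≤ ρ̄ / 2`). At DEPTH `j ≥ 2` both carriers entering
the bond equation `ḃ(-j) = -lam^{-4j/5} b + lam^{-j} b (a(-j) - a(1-j)) + ε lam^{-j} a(-j)²` are trail
carriers, so the rate is `lam^{-j} (2ρ̄ qʲ + 2ρ̄ q^{j-1}) ≤ 4 ρ̄ lam^{-4j/5}` and the seed is
`ε lam^{-j} (2ρ̄ qʲ)² = 4 ε ρ̄² qʲ lam^{-4j/5}`; linear Grönwall (`trail_bond_bound`) gives
`b(-j)(t) ≤ (b(-j)(0) + 4ερ̄² qʲ lam^{-4j/5} t) e^{4ρ̄ lam^{-4j/5} t}`.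
[folklore]
-/

noncomputable section

-- the summit namespace `…NavierStokesRegularity.NavierStokesRegularity…` is the tree convention
set_option linter.dupNamespace false

namespace Summit.NavierStokesRegularity.NavierStokesRegularity.Theorems.PerpetualPumpCircuitPump

open Set

/-- **DEEP TRAIL BONDS.** Under the hypotheses of `toda_trail_slaving`, the trail bonds at depth
`j ≥ 2` grow only at the DEPTH-DEPENDENT rate `4 ρb lam^{−4j/5}` (their coupling is `lam^{−j}` and both
neighbouring carriers are `≤ 2 ρb q^j`), with seed `≤ 4 ε ρb² q^j lam^{−4j/5}`: the summable rates
that keep the trail bond boxes `σ_j = σ̄ q^j e^{E_j}` with `E_j` bounded. [folklore] -/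
theorem toda_trail_bonds_deep :
    ∀ (lam ε T R₀ ρb σb : ℝ) (L : ℕ) (a b : ℤ → ℝ → ℝ), 1 < lam → lam ≤ 2 → 0 ≤ ε → ε ≤ 1 → 0 < T → T ≤ 1 / 2 → 0 ≤ R₀ → 1 ≤ ρb → 0 ≤ σb → 2 * (σb + 4 * ε * ρb ^ 2 * T) ^ 2 * Real.exp (2 * (4 * ρb + R₀) * T) * T ≤ ρb / 2 → (∀ n : ℤ, (L : ℤ) < |n| → ∀ t ∈ Set.Icc 0 T, a n t = 0 ∧ b n t = 0) → (∀ n : ℤ, |n| ≤ (L : ℤ) → ContinuousOn (a n) (Set.Icc 0 T) ∧ ContinuousOn (b n) (Set.Icc 0 T)) → (∀ n : ℤ, |n| ≤ (L : ℤ) → ∀ t ∈ Set.Ico 0 T, HasDerivWithinAt (a n) (-(lam ^ ((4 / 5 : ℝ) * n)) * a n t - lam ^ (n : ℝ) * b n t ^ 2 + lam ^ ((n : ℝ) - 1) * b (n - 1) t ^ 2 - ε * lam ^ (n : ℝ) * a n t * b n t) (Set.Ici t) t ∧ HasDerivWithinAt (b n) (-(lam ^ ((4 / 5 : ℝ) *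 n)) * b n t + lam ^ (n : ℝ) * b n t * (a n t - a (n + 1) t) + ε * lam ^ (n : ℝ) * a n t ^ 2) (Set.Ici t) t) → (∀ n : ℤ, 0 ≤ b n 0) → (∀ t ∈ Set.Icc 0 T, -R₀ ≤ a 0 t) → (∀ j : ℕ, 1 ≤ j → |a (-(j : ℤ)) 0| ≤ ρb * lam ^ ((j : ℝ) / 5) * (2 - lam ^ (-(4 / 5 : ℝ) * j)) ∧ b (-(j : ℤ)) 0 ≤ σb * lam ^ ((j : ℝ) / 5)) → ∀ t ∈ Set.Icc 0 T, ∀ j : ℕ, 2 ≤ j →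
      b (-(j : ℤ)) t ≤ (b (-(j : ℤ)) 0 + 4 * ε * ρb ^ 2 * lam ^ ((j : ℝ) / 5) * lam ^ (-(4 / 5 : ℝ) * j) * t) *
        Real.exp (4 * ρb * lam ^ (-(4 / 5 : ℝ) * j) * t) := by
  intro lam ε T R₀ ρb σb L a b hlam1 hlam2 hε0 hε1 hT hT2 hR₀ hρb hσb hFT hzero hcont hode hb0
    ha0 hinit
  have hslave := toda_trail_slaving lam ε T R₀ ρb σb L a b hlam1 hlam2 hε0 hε1 hT hT2 hR₀ hρb hσb
    hFT hzero hcont hode hb0 ha0 hinit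
  have hlam0 : 0 < lam := by linarith
  have hρ0 : 0 < ρb := by linarith
  -- index and `rpow` bookkeeping
  have habs : ∀ j : ℕ, |(-(j : ℤ))| = (j : ℤ) := fun j => by rw [abs_neg, Nat.abs_cast]
  have hcast : ∀ j : ℕ, ((-(j : ℤ) : ℤ) : ℝ) = -(j : ℝ) := fun j => by
    simp only [Int.cast_neg, Int.cast_natCast]
  have hrp : ∀ x : ℝ, 0 < lam ^ x := fun x => Real.rpow_pos_of_pos hlam0 x
  have hradd : ∀ x y : ℝ, lam ^ x * lam ^ y = lam ^ (x + y) := fun x y =>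
    (Real.rpow_add hlam0 x y).symm
  -- the crude carrier envelope `|a(-j)| ≤ 2 ρ̄ qʲ` on the whole window, all `j ≥ 1`
  have henv : ∀ s ∈ Icc 0 T, ∀ j : ℕ, 1 ≤ j → |a (-(j : ℤ)) s| ≤ 2 * ρb * lam ^ ((j : ℝ) / 5) := by
    intro s hs j hj
    have hc := (hslave s hs j hj).2.2
    have hi := (hinit j hj).1
    have h1 : 2 * (σb + 4 * ε * ρb ^ 2 * T) ^ 2 * Real.exp (2 * (4 * ρb + R₀) * T) *
        lam ^ ((j : ℝ) / 5) * lam ^ (-(4 / 5 : ℝ) * j) * s ≤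
        ρb / 2 * (lam ^ ((j : ℝ) / 5) * lam ^ (-(4 / 5 : ℝ) * j)) :=
      calc 2 * (σb + 4 * ε * ρb ^ 2 * T) ^ 2 * Real.exp (2 * (4 * ρb + R₀) * T) *
            lam ^ ((j : ℝ) / 5) * lam ^ (-(4 / 5 : ℝ) * j) * s
          ≤ 2 * (σb + 4 * ε * ρb ^ 2 * T) ^ 2 * Real.exp (2 * (4 * ρb + R₀) * T) *
            lam ^ ((j : ℝ) / 5) * lam ^ (-(4 / 5 : ℝ) * j) * T :=
            mul_le_mul_of_nonneg_left hs.2 (by positivity)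
        _ = 2 * (σb + 4 * ε * ρb ^ 2 * T) ^ 2 * Real.exp (2 * (4 * ρb + R₀) * T) * T *
            (lam ^ ((j : ℝ) / 5) * lam ^ (-(4 / 5 : ℝ) * j)) := by ring
        _ ≤ ρb / 2 * (lam ^ ((j : ℝ) / 5) * lam ^ (-(4 / 5 : ℝ) * j)) :=
            mul_le_mul_of_nonneg_right hFT (by positivity)
    have h2 : 0 ≤ ρb * (lam ^ ((j : ℝ) / 5) * lam ^ (-(4 / 5 : ℝ) * j)) := by positivity
    linarith
  intro t ht j hj
  rcases le_or_gt j L with hjL | hjL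
  · obtain ⟨i, rfl⟩ : ∃ i, j = i + 1 := ⟨j - 1, by omega⟩
    have hi1 : 1 ≤ i := by omega
    have hn : |(-((i + 1 : ℕ) : ℤ))| ≤ (L : ℤ) := by rw [habs]; exact_mod_cast hjL
    have hidx : -((i + 1 : ℕ) : ℤ) + 1 = -(i : ℤ) := by push_cast; ring
    have e1 : lam ^ (-((i : ℝ) + 1)) * lam ^ (((i : ℝ) + 1) / 5) =
        lam ^ (-(4 / 5 : ℝ) * ((i : ℝ) + 1)) := by
      rw [hradd]; congr 1; ring
    have e2 : lam ^ ((i : ℝ) / 5) ≤ lam ^ (((i : ℝ) + 1) / 5) :=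
      Real.rpow_le_rpow_of_exponent_le hlam1.le (by linarith)
    have hrate : lam ^ (((-((i + 1 : ℕ) : ℤ)) : ℤ) : ℝ) *
        (2 * ρb * lam ^ (((i + 1 : ℕ) : ℝ) / 5) + 2 * ρb * lam ^ ((i : ℝ) / 5)) ≤
        4 * ρb * lam ^ (-(4 / 5 : ℝ) * ((i + 1 : ℕ) : ℝ)) := by
      rw [hcast]; push_cast
      calc lam ^ (-((i : ℝ) + 1)) * (2 * ρb * lam ^ (((i : ℝ) + 1) / 5) + 2 * ρb * lam ^ ((i : ℝ) / 5))
          ≤ lam ^ (-((i : ℝ) + 1)) *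
            (2 * ρb * lam ^ (((i : ℝ) + 1) / 5) + 2 * ρb * lam ^ (((i : ℝ) + 1) / 5)) :=
            mul_le_mul_of_nonneg_left (by nlinarith) (hrp _).le
        _ = 4 * ρb * (lam ^ (-((i : ℝ) + 1)) * lam ^ (((i : ℝ) + 1) / 5)) := by ring
        _ = 4 * ρb * lam ^ (-(4 / 5 : ℝ) * ((i : ℝ) + 1)) := by rw [e1]
    have hseed : ε * lam ^ (((-((i + 1 : ℕ) : ℤ)) : ℤ) : ℝ) *
        (2 * ρb * lam ^ (((i + 1 : ℕ) : ℝ) / 5)) ^ 2 ≤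
        4 * ε * ρb ^ 2 * lam ^ (((i + 1 : ℕ) : ℝ) / 5) * lam ^ (-(4 / 5 : ℝ) * ((i + 1 : ℕ) : ℝ)) := by
      rw [hcast]; push_cast
      calc ε * lam ^ (-((i : ℝ) + 1)) * (2 * ρb * lam ^ (((i : ℝ) + 1) / 5)) ^ 2
          = 4 * ε * ρb ^ 2 * lam ^ (((i : ℝ) + 1) / 5) *
              (lam ^ (-((i : ℝ) + 1)) * lam ^ (((i : ℝ) + 1) / 5)) := by ring
        _ ≤ 4 * ε * ρb ^ 2 * lam ^ (((i : ℝ) + 1) / 5) * lam ^ (-(4 / 5 : ℝ) * ((i : ℝ) + 1)) := by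
            rw [e1]
    exact trail_bond_bound (β := b (-((i + 1 : ℕ) : ℤ))) (α := a (-((i + 1 : ℕ) : ℤ)))
      (α₁ := a (-((i + 1 : ℕ) : ℤ) + 1)) (M₁ := 2 * ρb * lam ^ ((i : ℝ) / 5))
      (hcont _ hn).2 (fun s hs => (hode _ hn s hs).2)
      (fun s hs => (hslave s hs _ (by omega)).1) (fun s hs => henv s hs _ (by omega))
      (fun s hs => by
        rw [hidx]
        linarith [neg_abs_le (a (-(i : ℤ)) s), henv s hs i hi1])
      (hrp _).le (hrp _).le hε0 hrate (by positivity) hseed (by positivity) t ht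
  · have hn : (L : ℤ) < |(-(j : ℤ))| := by rw [habs]; exact_mod_cast hjL
    rw [(hzero _ hn t ht).2, (hzero _ hn 0 ⟨le_rfl, hT.le⟩).2, zero_add]
    have := ht.1; positivity

end Summit.NavierStokesRegularity.NavierStokesRegularity.Theorems.PerpetualPumpCircuitPump
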